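import Summits.MatrixMultiplication.MatrixMultiplication.Theorems.FarEdgeDescentStrassenFloorShift
import Summits.MatrixMultiplication.MatrixMultiplication.Theorems.FarEdgeDescentTower
import HarnessLib

/-!
# Far-edge descent, kernel XXXIX-D: the CYCLIC pair in characteristic zero — Strassen's `3/2` for direct sums, `β ≥ 3/2`

Route `FarEdgeDescent`, special leaf `FiniteSaturation` (stmt-MatrixMultiplication-23739): helper
kernel, THESES-FREE (decomp-mm lens 2 «structural dichotomy: special vs generic», gen 59).

Kernels XXXIX-A/B ran Strassen's equation (BCS Thm. 19.12) on `D = ⊕ᵢ⟨kᵢ,mᵢ,kᵢ⟩` with the unit pair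
(`E₁₀, E₀₁`: surplus `mᵢ` per block) and the shift pair (`D, N`: surplus `(kᵢ−1)mᵢ/2`), characteristic-free,
giving `4L ≤ 3R̲(D)`.  Over a field of CHARACTERISTIC ZERO (the route's field is `ℂ`) the pair of BCS
Cor. (19.14) needs no scalar extension: with the cyclic permutation `P = ∑_r E_{r, r−1 mod kᵢ}` and
`D = diag(0,1,…,kᵢ−1)` in the blocks of `S`,

  `D·P − P·D = diag(c)·P`,  `c_{(i;κ,μ)} = κ − (κ−1 mod kᵢ) ∈ {1, −(kᵢ−1)}` — all non-zero in characteristic `0`,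

so the commutator has the rank of the permutation slice `P`, i.e. `∑_{i∈S} kᵢmᵢ` (`P·Pᵀ = 1` on the blocks
of `S`), and Strassen's equation gives

* `floor_cyclic`:  `2∑ᵢ kᵢmᵢ + ∑_{i∈S} kᵢmᵢ ≤ 2R̲(⊕ᵢ⟨kᵢ,mᵢ,kᵢ⟩)`  (`char K = 0`, `kᵢ ≥ 2` on `S`);
* `strassen_floor`:  **`3∑ᵢ kᵢmᵢ ≤ 2R̲(⊕ᵢ⟨kᵢ,mᵢ,kᵢ⟩)`** when every block is genuine — BCS (19.14)'s
  `R̲(⟨m,m,m⟩) ≥ 3m²/2` extended verbatim to direct sums of `⟨k,m,k⟩`'s: border rank ≥ `3/2` of the `x`-count;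
* `anchored_strassen_floor` (`2Q + 3L ≤ 2R̲(⟨1,Q,1⟩ ⊕ legs)`), `budget_floor_strassen`: the budget factor of
  the anchor-budget dial satisfies **`β ≥ 3/2`** for every anchored direct sum of genuine matrix products over a
  field of characteristic zero — every anchor `Q`, every number and width of legs.  In the dial model (kernel
  XXXVIII) every such toolbox is passed by the power world at order `≤ θ_{3/2} = log(3/2)/log(4/3) = 1.409…`;
  the dial range `1 ≤ β < 3/2` (where `θ_β > 1.41`, degenerating as `β → 1⁺`) is EMPTY of tensors of this class;
* `multiple_strassen_floor` (`3cAM ≤ 2R̲(⟨c⟩ ⊗ ⟨A,M,A⟩)`), `readout_strassen_floor` (`3cAM ≤ 2r` for any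
  certificate fed to the one-shot readout of XXXIX-C).

What remains tensor-open is the range `3/2 ≤ β < 2`: Schönhage's objects realise `β = 2`
(`R̲(⟨a,1,a⟩ ⊕ ⟨1,(a−1)²,1⟩) = a² + 1`), Strassen's equation forbids `β < 3/2`, and no anchored direct sum
with `R̲ < Q + 2L` is known (memo NODE-g53 §3(e)).

SCOPE / HONESTY.  An explicit instance of BCS (19.12) with the witnesses of the proof of (19.14); new is only
the instantiation on the tree's `matMulDirectSum` with block-dependent cyclic permutations and the anchored /
multiple corollaries.  Positive characteristic is covered by XXXIX-B's `4/3` (the `3/2` there would need the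
scalar extension `K(X)` of (19.14), not formalised for direct sums).  Definitions: `cpred`, `gP`, `gPt` only.

## References
* P. Bürgisser, M. Clausen, M. A. Shokrollahi, *Algebraic Complexity Theory*, Springer 1997, Thm. (19.12),
  Cor. (19.14). [BurgisserClausenShokrollahi1997]
* M. Bläser, *Fast Matrix Multiplication*, ToC Graduate Surveys 5 (2013), §7. [Blaser2013]
* A. Schönhage, SIAM J. Comput. 10 (1981), §5. [Schonhage1981]
-/

noncomputable section

open scoped BigOperators Matrix
open Matrix

set_option linter.dupNamespace false

namespace Summit.MatrixMultiplication.MatrixMultiplication.Theorems.FarEdgeDescentStrassenFloorCyclic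

open Literature.Computability.AlgebraicComplexity
open Summit.MatrixMultiplication.MatrixMultiplication.Theorems.FarEdgeDescentStrassenFloor
open Summit.MatrixMultiplication.MatrixMultiplication.Theorems.FarEdgeDescentStrassenFloorShift

variable (K : Type) [Field K] {p : ℕ}

/-! ## §1 The cyclic predecessor and the permutation tables -/

/-- Cyclic predecessor of a row index in block `i`: `0 ↦ kᵢ − 1`, `r ↦ r − 1` otherwise. -/
def cpred (k : Fin p → ℕ) (i : Fin p) (r : ℕ) : ℕ := if r = 0 then k i - 1 else r - 1

/-- The cyclic predecessor stays inside the block. -/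
theorem cpred_lt (k : Fin p → ℕ) (i : Fin p) {r : ℕ} (hr : r < k i) : cpred k i r < k i := by
  unfold cpred; split_ifs <;> omega

/-- The cyclic predecessor is injective on the block. -/
theorem cpred_inj (k : Fin p → ℕ) (i : Fin p) {r r' : ℕ} (hr : r < k i) (hr' : r' < k i)
    (h : cpred k i r = cpred k i r') : r = r' := by
  unfold cpred at h; split_ifs at h <;> omega

/-- The weight `r − cpred r` is `1` or `−(kᵢ−1)`: non-zero in characteristic zero when `kᵢ ≥ 2`.
[cite: BurgisserClausenShokrollahi1997, Cor. (19.14) (proof)] -/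
theorem weight_ne_zero [CharZero K] (k : Fin p → ℕ) (i : Fin p) {r : ℕ} (hk : 2 ≤ k i) :
    ((r : ℕ) : K) - ((cpred k i r : ℕ) : K) ≠ 0 := by
  unfold cpred
  split_ifs with h0
  · subst h0
    rw [Nat.cast_zero, zero_sub, neg_ne_zero]
    exact Nat.cast_ne_zero.2 (by omega)
  · have e : ((r : ℕ) : K) - ((r - 1 : ℕ) : K) = 1 := by
      rw [Nat.cast_sub (by omega : 1 ≤ r)]; push_cast; ring
    rw [e]; exact one_ne_zero

/-- Coefficient table of the cyclic permutation `P = ∑_r z⁽ⁱ⁾_{r, cpred r}` in the blocks `i ∈ S`. -/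
def gP (k : Fin p → ℕ) (S : Finset (Fin p)) : Fin p → ℕ → ℕ → K :=
  fun i r s => if i ∈ S ∧ s = cpred k i r then 1 else 0

/-- Coefficient table of the transposed cyclic permutation `Pᵀ` in the blocks `i ∈ S`. -/
def gPt (k : Fin p → ℕ) (S : Finset (Fin p)) : Fin p → ℕ → ℕ → K :=
  fun i r s => if i ∈ S ∧ r = cpred k i s then 1 else 0

/-- Entry formula of the permutation slice. [cite: BurgisserClausenShokrollahi1997, Thm. (19.12)] -/
theorem slice_gP_apply (k m : Fin p → ℕ) (S : Finset (Fin p)) (x x' : Σ i, Fin (k i) × Fin (m i)) :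
    slice K k m (gP K k S) x x' =
      if (x.1 = x'.1 ∧ (x.2.2 : ℕ) = x'.2.2) ∧ (x.1 ∈ S ∧ (x'.2.1 : ℕ) = cpred k x.1 x.2.1)
      then 1 else 0 := by
  rw [slice_apply]
  simp only [gP]
  by_cases h : x.1 = x'.1 ∧ (x.2.2 : ℕ) = x'.2.2
  · rw [if_pos h]
    simp only [h, true_and]
  · rw [if_neg h, if_neg (fun h' => h h'.1)]

/-- Entry formula of the transposed permutation slice. [cite: BurgisserClausenShokrollahi1997, Thm. (19.12)] -/
theorem slice_gPt_apply (k m : Fin p → ℕ) (S : Finset (Fin p)) (x x' : Σ i, Fin (k i) × Fin (m i)) :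
    slice K k m (gPt K k S) x x' =
      if (x.1 = x'.1 ∧ (x.2.2 : ℕ) = x'.2.2) ∧ (x.1 ∈ S ∧ (x.2.1 : ℕ) = cpred k x.1 x'.2.1)
      then 1 else 0 := by
  rw [slice_apply]
  simp only [gPt]
  by_cases h : x.1 = x'.1 ∧ (x.2.2 : ℕ) = x'.2.2
  · rw [if_pos h]
    simp only [h, true_and]
  · rw [if_neg h, if_neg (fun h' => h h'.1)]

/-! ## §2 `P·Pᵀ`, `[D, P] = diag(c)·P` -/

/-- `P · Pᵀ` is the `0/1` diagonal matrix supported on the selected blocks.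
[cite: BurgisserClausenShokrollahi1997, Thm. (19.12)] -/
theorem slice_gP_mul_gPt (k m : Fin p → ℕ) (S : Finset (Fin p)) :
    Matrix.of (slice K k m (gP K k S)) * Matrix.of (slice K k m (gPt K k S)) =
      diagonal (fun x => if x.1 ∈ S then (1 : K) else 0) := by
  classical
  ext x x''
  rw [mul_apply, diagonal_apply]
  simp only [of_apply, slice_gP_apply, slice_gPt_apply]
  by_cases H : x.1 ∈ S
  · set y₀ : (Σ i, Fin (k i) × Fin (m i)) :=
      ⟨x.1, (⟨cpred k x.1 x.2.1, cpred_lt k x.1 x.2.1.isLt⟩, x.2.2)⟩ with hy₀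
    rw [Finset.sum_eq_single_of_mem y₀ (Finset.mem_univ _)]
    · have h1 : ((x.1 = y₀.1 ∧ (x.2.2 : ℕ) = y₀.2.2) ∧ (x.1 ∈ S ∧ (y₀.2.1 : ℕ) = cpred k x.1 x.2.1)) :=
        ⟨⟨rfl, rfl⟩, H, rfl⟩
      rw [if_pos h1, one_mul, if_pos H]
      by_cases hxx : x = x''
      · subst hxx
        rw [if_pos rfl, if_pos ⟨⟨rfl, rfl⟩, H, rfl⟩]
      · rw [if_neg hxx, ite_eq_right_iff]
        rintro ⟨⟨h1', h2'⟩, -, h4'⟩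
        have hk : k x''.1 = k x.1 := by rw [h1']
        have hlt'' : (x''.2.1 : ℕ) < k x.1 := hk ▸ x''.2.1.isLt
        have e := cpred_inj k x.1 x.2.1.isLt hlt'' h4'
        exact absurd ((sigma_eq_iff x x'').2 ⟨h1', e, h2'⟩) hxx
    · intro y _ hne
      have hz : (if (x.1 = y.1 ∧ (x.2.2 : ℕ) = y.2.2) ∧ (x.1 ∈ S ∧ (y.2.1 : ℕ) = cpred k x.1 x.2.1)
          then (1 : K) else 0) = 0 := by
        rw [ite_eq_right_iff]
        rintro ⟨⟨h1', h2'⟩, -, h4'⟩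
        exact absurd ((sigma_eq_iff y y₀).2 ⟨h1'.symm, h4', h2'.symm⟩) hne
      rw [hz, zero_mul]
  · rw [if_neg H, ite_self]
    refine Finset.sum_eq_zero fun y _ => ?_
    have hz : (if (x.1 = y.1 ∧ (x.2.2 : ℕ) = y.2.2) ∧ (x.1 ∈ S ∧ (y.2.1 : ℕ) = cpred k x.1 x.2.1)
        then (1 : K) else 0) = 0 := by
      rw [ite_eq_right_iff]
      rintro ⟨-, h3', -⟩
      exact absurd h3' H
    rw [hz, zero_mul]

/-- **`[D, P] = diag(c)·P`** slice-wise, with the weights `c_{(i;κ,μ)} = κ − cpred κ` on the selected blocks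
(and `1` elsewhere, where `P` vanishes). [cite: BurgisserClausenShokrollahi1997, Cor. (19.14) (proof)] -/
theorem slice_comm_gD_gP (k m : Fin p → ℕ) (S : Finset (Fin p)) :
    Matrix.of (slice K k m (gD K S)) * Matrix.of (slice K k m (gP K k S)) -
        Matrix.of (slice K k m (gP K k S)) * Matrix.of (slice K k m (gD K S)) =
      diagonal (fun x : (Σ i, Fin (k i) × Fin (m i)) =>
          if x.1 ∈ S then ((x.2.1 : ℕ) : K) - ((cpred k x.1 x.2.1 : ℕ) : K) else 1) *
        Matrix.of (slice K k m (gP K k S)) := by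
  classical
  rw [slice_gD_diag]
  ext x y
  simp only [Matrix.sub_apply, diagonal_mul, mul_diagonal, of_apply, slice_gP_apply]
  by_cases hc : (x.1 = y.1 ∧ (x.2.2 : ℕ) = y.2.2) ∧ (x.1 ∈ S ∧ (y.2.1 : ℕ) = cpred k x.1 x.2.1)
  · have hyS : y.1 ∈ S := hc.1.1 ▸ hc.2.1
    have e1 : (if (x.1 = y.1 ∧ (x.2.2 : ℕ) = y.2.2) ∧ (x.1 ∈ S ∧ (y.2.1 : ℕ) = cpred k x.1 x.2.1)
        then (1 : K) else 0) = 1 := if_pos hc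
    have e2 : (if x.1 ∈ S then ((x.2.1 : ℕ) : K) else 0) = ((x.2.1 : ℕ) : K) := if_pos hc.2.1
    have e3 : (if y.1 ∈ S then ((y.2.1 : ℕ) : K) else 0) = ((y.2.1 : ℕ) : K) := if_pos hyS
    have e4 : (if x.1 ∈ S then ((x.2.1 : ℕ) : K) - ((cpred k x.1 x.2.1 : ℕ) : K) else 1) =
        ((x.2.1 : ℕ) : K) - ((cpred k x.1 x.2.1 : ℕ) : K) := if_pos hc.2.1
    rw [e1, e2, e3, e4, hc.2.2]
    ring
  · rw [if_neg hc, mul_zero, zero_mul, sub_zero, mul_zero]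

/-! ## §3 The cyclic floor, Strassen's `3/2` for direct sums, and the corollaries -/

/-- **THE CYCLIC FLOOR** (characteristic zero): `2∑ᵢ kᵢmᵢ + ∑_{i∈S} kᵢmᵢ ≤ 2R̲(⊕ᵢ ⟨kᵢ,mᵢ,kᵢ⟩)` for every
set `S` of blocks with `kᵢ ≥ 2` — Strassen's equation with `A = 1`, `B = D`, `C = P`: the commutator
`diag(c)·P` has the rank of `P`, which is `∑_{i∈S} kᵢmᵢ`. [cite: BurgisserClausenShokrollahi1997, Thm. (19.12)] -/
theorem floor_cyclic [CharZero K] (k m : Fin p → ℕ) (S : Finset (Fin p)) (hS : ∀ i ∈ S, 2 ≤ k i) :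
    2 * ∑ i, k i * m i + ∑ i ∈ S, k i * m i ≤ 2 * algBorderRank (matMulDirectSum K k m k) := by
  classical
  set tab : Fin 3 → Fin p → ℕ → ℕ → K := ![gId K, gD K S, gP K k S] with htab
  set t : Fin 3 → (Σ i, Fin (k i) × Fin (m i)) → (Σ i, Fin (k i) × Fin (m i)) → K :=
    fun j => slice K k m (tab j) with ht
  have hle : algBorderRank t ≤ algBorderRank (matMulDirectSum K k m k) :=
    algBorderRank_slices_le K k m tab
  have h0 : Matrix.of (t 0) = 1 := slice_gId K k m
  have h1 : t 1 = slice K k m (gD K S) := rfl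
  have h2 : t 2 = slice K k m (gP K k S) := rfl
  have hBCS := BCS1997_thm_19_12 t 0 1 2 (by rw [h0, det_one]; exact isUnit_one)
  rw [h0, inv_one, Matrix.mul_one, Matrix.mul_one, h1, h2, slice_comm_gD_gP] at hBCS
  -- the weight matrix is invertible in characteristic zero
  have hdet : IsUnit (diagonal (fun x : (Σ i, Fin (k i) × Fin (m i)) =>
      if x.1 ∈ S then ((x.2.1 : ℕ) : K) - ((cpred k x.1 x.2.1 : ℕ) : K) else 1)).det := by
    rw [det_diagonal, isUnit_iff_ne_zero, Finset.prod_ne_zero_iff]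
    intro x _
    by_cases hx : x.1 ∈ S
    · rw [if_pos hx]; exact weight_ne_zero K k x.1 (hS x.1 hx)
    · rw [if_neg hx]; exact one_ne_zero
  rw [Matrix.rank_mul_eq_right_of_isUnit_det _ _ hdet] at hBCS
  -- rank of the permutation slice ≥ rank of `P Pᵀ` = number of rows in the selected blocks
  set w : (Σ i, Fin (k i) × Fin (m i)) → K := fun x => if x.1 ∈ S then (1 : K) else 0 with hw
  have hrk : (diagonal w).rank ≤ (Matrix.of (slice K k m (gP K k S))).rank := by
    rw [← slice_gP_mul_gPt]
    exact Matrix.rank_mul_le_left _ _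
  set c : Fin p → ℕ := fun i => if i ∈ S then k i else 0 with hc
  have hcS : ∀ y : (Σ i, Fin (c i) × Fin (m i)), y.1 ∈ S := by
    intro y
    by_contra hy
    have := y.2.1.isLt
    simp [hc, hy] at this
  have hclt : ∀ y : (Σ i, Fin (c i) × Fin (m i)), (y.2.1 : ℕ) < k y.1 := by
    intro y
    have hy := hcS y
    have := y.2.1.isLt
    simpa [hc, hy] using this
  have hwne : ∀ y : (Σ i, Fin (c i) × Fin (m i)), w ⟨y.1, (⟨(y.2.1 : ℕ), hclt y⟩, y.2.2)⟩ ≠ 0 := by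
    intro y
    have hy := hcS y
    simp [hw, hy]
  set φ : (Σ i, Fin (c i) × Fin (m i)) → {x : (Σ i, Fin (k i) × Fin (m i)) // w x ≠ 0} :=
    fun y => ⟨⟨y.1, (⟨(y.2.1 : ℕ), hclt y⟩, y.2.2)⟩, hwne y⟩ with hφ
  have hφinj : Function.Injective φ := by
    intro y y' h
    have h' : (⟨y.1, (⟨(y.2.1 : ℕ), hclt y⟩, y.2.2)⟩ : Σ i, Fin (k i) × Fin (m i)) =
        ⟨y'.1, (⟨(y'.2.1 : ℕ), hclt y'⟩, y'.2.2)⟩ := congrArg Subtype.val h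
    obtain ⟨e1, e2, e3⟩ := (sigma_eq_iff _ _).1 h'
    exact (sigma_eq_iff y y').2 ⟨e1, e2, e3⟩
  have hcard : Fintype.card (Σ i, Fin (c i) × Fin (m i)) = ∑ i ∈ S, k i * m i := by
    simp only [Fintype.card_sigma, Fintype.card_prod, Fintype.card_fin, hc, ite_mul, zero_mul]
    exact Fintype.sum_ite_mem S (fun i => k i * m i)
  have hsub : ∑ i ∈ S, k i * m i ≤ (diagonal w).rank := by
    rw [Matrix.rank_diagonal, ← hcard]
    exact Fintype.card_le_of_injective φ hφinj
  have hX : Fintype.card (Σ i, Fin (k i) × Fin (m i)) = ∑ i, k i * m i := by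
    simp [Fintype.card_prod]
  omega

/-- **STRASSEN'S `3/2` FOR DIRECT SUMS** (characteristic zero): if every block is genuine (`kᵢ ≥ 2`) then
`3∑ᵢ kᵢmᵢ ≤ 2R̲(⊕ᵢ⟨kᵢ,mᵢ,kᵢ⟩)` — BCS Cor. (19.14)'s `R̲(⟨m,m,m⟩) ≥ 3m²/2`, verbatim for direct sums of
`⟨k,m,k⟩`'s. [cite: BurgisserClausenShokrollahi1997, Cor. (19.14)] -/
theorem strassen_floor [CharZero K] (k m : Fin p → ℕ) (hk : ∀ i, 2 ≤ k i) :
    3 * ∑ i, k i * m i ≤ 2 * algBorderRank (matMulDirectSum K k m k) := by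
  classical
  have h := floor_cyclic K k m Finset.univ (fun i _ => hk i)
  omega

/-- The cyclic floor for anchored objects: `2Q + 3L ≤ 2R̲(⟨1,Q,1⟩ ⊕ ⊕ᵢ⟨kᵢ,mᵢ,kᵢ⟩)` when every leg is
genuine, characteristic zero. [cite: BurgisserClausenShokrollahi1997, Thm. (19.12)] -/
theorem anchored_strassen_floor [CharZero K] (k m : Fin p → ℕ) (Q : ℕ) (hk : ∀ i, 2 ≤ k i) :
    2 * Q + 3 * ∑ i, k i * m i ≤
      2 * algBorderRank (matMulDirectSum K (Fin.cons 1 k) (Fin.cons Q m) (Fin.cons 1 k)) := by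
  classical
  have hS' : ∀ j ∈ (Finset.univ : Finset (Fin p)).map (Fin.succEmb p),
      2 ≤ (Fin.cons 1 k : Fin (p + 1) → ℕ) j := by
    intro j hj
    rw [Finset.mem_map] at hj
    obtain ⟨i, -, rfl⟩ := hj
    simpa using hk i
  have hf := floor_cyclic K (Fin.cons 1 k) (Fin.cons Q m) (Finset.univ.map (Fin.succEmb p)) hS'
  rw [Finset.sum_map] at hf
  have e1 : ∑ j : Fin (p + 1), (Fin.cons 1 k : Fin (p + 1) → ℕ) j * (Fin.cons Q m : Fin (p + 1) → ℕ) j =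
      Q + ∑ i, k i * m i := by
    simp [Fin.sum_univ_succ]
  have e2 : ∑ i : Fin p, (Fin.cons 1 k : Fin (p + 1) → ℕ) ((Fin.succEmb p) i) *
      (Fin.cons Q m : Fin (p + 1) → ℕ) ((Fin.succEmb p) i) = ∑ i, k i * m i := by
    simp
  omega

/-- **`β ≥ 3/2` in characteristic zero.**  If an anchored direct sum `⟨1,Q,1⟩ ⊕ ⊕ᵢ⟨kᵢ,mᵢ,kᵢ⟩` with genuine
legs and leg mass `L > 0` admits a certificate `R̲ ≤ Q + β·L` over a field of characteristic zero, then
`β ≥ 3/2`: in the dial model every such toolbox is passed by the power world at order `≤ θ_{3/2} = 1.409…`.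
[cite: BurgisserClausenShokrollahi1997, Cor. (19.14)] -/
theorem budget_floor_strassen [CharZero K] (k m : Fin p → ℕ) (Q : ℕ) (hk : ∀ i, 2 ≤ k i)
    (hL : 0 < ∑ i, k i * m i) {β : ℝ}
    (h : (algBorderRank (matMulDirectSum K (Fin.cons 1 k) (Fin.cons Q m) (Fin.cons 1 k)) : ℝ) ≤
      Q + β * ∑ i, k i * m i) :
    3 / 2 ≤ β := by
  have hf := anchored_strassen_floor K k m Q hk
  have hR : ((2 * Q + 3 * ∑ i, k i * m i : ℕ) : ℝ) ≤
      2 * (algBorderRank (matMulDirectSum K (Fin.cons 1 k) (Fin.cons Q m) (Fin.cons 1 k)) : ℝ) := by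
    exact_mod_cast hf
  have hf' : ((2 * Q + 3 * ∑ i, k i * m i : ℕ) : ℝ) ≤ 2 * (Q + β * ∑ i, k i * m i) :=
    hR.trans (by linarith)
  have hL' : (0 : ℝ) < ((∑ i, k i * m i : ℕ) : ℝ) := by exact_mod_cast hL
  push_cast at hf' hL' ⊢
  set L : ℝ := ∑ i, ((k i : ℝ) * (m i : ℝ)) with hLdef
  have h2 : (3 / 2 : ℝ) * L ≤ β * L := by linarith
  exact le_of_mul_le_mul_right h2 hL'

/-- The anchored pair in characteristic zero: `2Q + 3aB ≤ 2R̲(⟨1,Q,1⟩ ⊕ ⟨a,B,a⟩)`, `a ≥ 2`.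
[cite: BurgisserClausenShokrollahi1997, Cor. (19.14)] -/
theorem anchoredPair_strassen_floor [CharZero K] (Q a B : ℕ) (ha : 2 ≤ a) :
    2 * Q + 3 * (a * B) ≤ 2 * algBorderRank (matMulDirectSum K ![1, a] ![Q, B] ![1, a]) := by
  have hf := anchored_strassen_floor K ![a] ![B] Q (fun i => by fin_cases i; simpa using ha)
  simp only [Finset.univ_unique, Fin.default_eq_zero, Finset.sum_singleton, Matrix.cons_val_zero] at hf
  exact hf

/-- Bare multiples in characteristic zero: `3cAM ≤ 2R̲(⟨c⟩ ⊗ ⟨A,M,A⟩)` for `A ≥ 2`.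
[cite: BurgisserClausenShokrollahi1997, Cor. (19.14)] [cite: Blaser2013, §5.2 p. 24] -/
theorem multiple_strassen_floor [CharZero K] (c A M : ℕ) (hA : 2 ≤ A) :
    3 * (c * (A * M)) ≤ 2 * algBorderRank (kroneckerTensor (unitTensor K c) (matMulTensor K A M A)) := by
  classical
  have hf := strassen_floor K (fun _ : Fin c => A) (fun _ => M) (fun _ => hA)
  simp only [Finset.sum_const, Finset.card_univ, Fintype.card_fin, smul_eq_mul] at hf
  exact hf.trans (Nat.mul_le_mul_left 2
    (FarEdgeDescentTower.tensorRestrictsTo_multiple_directSum K c A M).algBorderRank_le)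

/-- The readout floor in characteristic zero: ANY certificate `R̲(⟨c⟩ ⊗ ⟨A,M,A⟩) ≤ r` fed to the one-shot
readout (XXXIX-C `readout`) has `3cAM ≤ 2r`. [cite: BurgisserClausenShokrollahi1997, Cor. (19.14)] -/
theorem readout_strassen_floor [CharZero K] {c A M r : ℕ} (hA : 2 ≤ A)
    (h : algBorderRank (kroneckerTensor (unitTensor K c) (matMulTensor K A M A)) ≤ r) :
    3 * (c * (A * M)) ≤ 2 * r :=
  (multiple_strassen_floor K c A M hA).trans (Nat.mul_le_mul_left 2 h)

end Summit.MatrixMultiplication.MatrixMultiplication.Theorems.FarEdgeDescentStrassenFloorCyclic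

end
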